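import Summits.ValiantsHypothesis.ValiantsHypothesis.Theorems.LacunarySymmetroidMatrixDescartesStubDescartesCeiling
import Summits.ValiantsHypothesis.ValiantsHypothesis.Theorems.MatrixDescartes.Negative.MatrixDescartesWitness24

/-!
# `MatrixDescartes` census — SUPPORT-LEVEL Descartes ceiling («the arithmetic floor of the UB table»)

HONEST FRAMING.  Object-search cell `pub-symmetroid`, crux `Theses.LacunarySymmetroid.MatrixDescartes`
(stmt-ValiantsHypothesis-18050).  The cell's support-level upper-bound table (DATA-CUT item (b): «ζ(m,K;d) ≤ ?» for
every exponent vector `d` in a box) has as its floor the trivial Descartes bound AT SUPPORT RESOLUTION: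
`Z₊(d,S) + 1 ≤ #{∑ᵢ d(f i) : f : Fin m → Fin K}` = the number of distinct elements of the `m`-fold sumset of `d`
(which is `< C(m+K−1,m)` exactly when `d` has an `m`-fold additive coincidence).  This file makes that floor a
kernel theorem for ALL formats and supports at once (`card_posRoots_succ_le_card_sumset`; symmetry of the `S l` is
not needed), with the pair / triple forms used by the `m = 2` / `m = 3` tables, so that any single entry of the
Descartes layer is an instance by `decide` on a finite image.  It is the tree's `stub_descartesCeiling`
(format level, `C(m+K−1,m)`) with the stars-and-bars step left out — nothing more; sharper support-level bounds
(Schur-positivity / word / parity certificates) are NOT formalised.  No claim about the crux or `VP ≠ VNP`.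

[folklore] Leibniz expansion + the sparse Descartes rule (tree
`Literature.Computability.AlgebraicComplexity.card_roots_toFinset_filter_pos_lt_card_support`).
-/

-- `Summit.ValiantsHypothesis.ValiantsHypothesis.…` repeats a component by the D-0017 layout
-- (single-conjunct summit), which the `dupNamespace` linter flags; the name is mandated.
set_option linter.dupNamespace false

namespace Summit.ValiantsHypothesis.ValiantsHypothesis.Theorems.LacunarySymmetroidMatrixDescartes.Census

open Summit.ValiantsHypothesis.ValiantsHypothesis.Theorems.MatrixDescartes.Negative (PosRootLawAt)
open Polynomial Finset
open scoped BigOperators Polynomial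

/-- The support of `det (∑ l, X^(d l) • S l)` lies in the `m`-fold sumset of `d`, written as the image of the
row-to-term maps `f : Fin m → Fin K` under `f ↦ ∑ᵢ d (f i)` (tree: `StubDescartesCeiling.coeff_det_pencil_eq_zero`).
[folklore] -/
theorem support_det_pencil_subset_sumset {K m : ℕ} (d : Fin K → ℕ) (S : Fin K → Matrix (Fin m) (Fin m) ℝ) :
    (Matrix.det (∑ l, ((Polynomial.X : Polynomial ℝ) ^ d l) • (S l).map Polynomial.C)).support
      ⊆ (Finset.univ : Finset (Fin m → Fin K)).image (fun f => ∑ i, d (f i)) := by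
  intro n hn
  rw [mem_support_iff] at hn
  by_contra h
  exact hn (StubDescartesCeiling.coeff_det_pencil_eq_zero d S fun f hf =>
    h (Finset.mem_image.mpr ⟨f, Finset.mem_univ _, hf⟩))

/-- **Support-level Descartes ceiling.**  For `K ≥ 1` terms and ANY real `m × m` matrices `S l`, the number of
distinct positive zeros of `det (∑ l, X^(d l) • S l)` plus one is at most the number of distinct `m`-fold sums
`∑ᵢ d (f i)`, `f : Fin m → Fin K` — i.e. `Z₊(d,S) ≤ |m-fold sumset of d| − 1`, the support's own Descartes count,
which is below the format ceiling `C(m+K−1,m) − 1` exactly when `d` has an `m`-fold additive coincidence.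
(`det ≡ 0`: no root is counted and the sumset is non-empty.) [folklore] -/
theorem card_posRoots_succ_le_card_sumset {K m : ℕ} (hK : 0 < K) (d : Fin K → ℕ)
    (S : Fin K → Matrix (Fin m) (Fin m) ℝ) :
    ((Matrix.det (∑ l, ((Polynomial.X : Polynomial ℝ) ^ d l) • (S l).map Polynomial.C)).roots.toFinset.filter
        (fun t => 0 < t)).card + 1
      ≤ ((Finset.univ : Finset (Fin m → Fin K)).image (fun f => ∑ i, d (f i))).card := by
  by_cases hP : Matrix.det (∑ l, ((Polynomial.X : Polynomial ℝ) ^ d l) • (S l).map Polynomial.C) = 0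
  · rw [hP, Polynomial.roots_zero, Multiset.toFinset_zero, Finset.filter_empty, Finset.card_empty,
      zero_add, Nat.succ_le_iff, Finset.card_pos, Finset.image_nonempty]
    exact ⟨fun _ => ⟨0, hK⟩, Finset.mem_univ _⟩
  · have h1 :=
      Literature.Computability.AlgebraicComplexity.card_roots_toFinset_filter_pos_lt_card_support hP
    have h2 := Finset.card_le_card (support_det_pencil_subset_sumset d S)
    exact Nat.succ_le_of_lt (lt_of_lt_of_le h1 h2)

/-- The `m = 2` form used by the `(2,K;d)` tables: `Z₊ + 1 ≤ #{d i + d j : i, j}` (pairs with repetition).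
[folklore] -/
theorem card_posRoots_two_succ_le_card_pairSums {K : ℕ} (hK : 0 < K) (d : Fin K → ℕ)
    (S : Fin K → Matrix (Fin 2) (Fin 2) ℝ) :
    ((Matrix.det (∑ l, ((Polynomial.X : Polynomial ℝ) ^ d l) • (S l).map Polynomial.C)).roots.toFinset.filter
        (fun t => 0 < t)).card + 1
      ≤ ((Finset.univ : Finset (Fin K × Fin K)).image (fun p => d p.1 + d p.2)).card := by
  refine (card_posRoots_succ_le_card_sumset hK d S).trans (Finset.card_le_card ?_)
  refine Finset.image_subset_iff.mpr fun f _ => Finset.mem_image.mpr ⟨(f 0, f 1), Finset.mem_univ _, ?_⟩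
  simp [Fin.sum_univ_two]

/-- The `m = 3` form used by the `(3,K;d)` tables: `Z₊ + 1 ≤ #{d i + d j + d k : i, j, k}`. [folklore] -/
theorem card_posRoots_three_succ_le_card_tripleSums {K : ℕ} (hK : 0 < K) (d : Fin K → ℕ)
    (S : Fin K → Matrix (Fin 3) (Fin 3) ℝ) :
    ((Matrix.det (∑ l, ((Polynomial.X : Polynomial ℝ) ^ d l) • (S l).map Polynomial.C)).roots.toFinset.filter
        (fun t => 0 < t)).card + 1
      ≤ ((Finset.univ : Finset (Fin K × Fin K × Fin K)).image (fun p => d p.1 + d p.2.1 + d p.2.2)).card := by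
  refine (card_posRoots_succ_le_card_sumset hK d S).trans (Finset.card_le_card ?_)
  refine Finset.image_subset_iff.mpr fun f _ =>
    Finset.mem_image.mpr ⟨(f 0, f 1, f 2), Finset.mem_univ _, ?_⟩
  simp [Fin.sum_univ_three, add_assoc]

/-- **A support-level law from a sumset count.**  If every pair sum table of `d` has at most `B + 1` distinct
values, then `Z₊ ≤ B` for every `2 × 2` pencil on the support `d` (symmetric or not). [folklore] -/
theorem posRoots_two_le_of_card_pairSums {K B : ℕ} (hK : 0 < K) (d : Fin K → ℕ)
    (hd : ((Finset.univ : Finset (Fin K × Fin K)).image (fun p => d p.1 + d p.2)).card ≤ B + 1)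
    (S : Fin K → Matrix (Fin 2) (Fin 2) ℝ) :
    ((Matrix.det (∑ l, ((Polynomial.X : Polynomial ℝ) ^ d l) • (S l).map Polynomial.C)).roots.toFinset.filter
        (fun t => 0 < t)).card ≤ B := by
  have h := (card_posRoots_two_succ_le_card_pairSums hK d S).trans hd
  omega

/-- The same at `m = 3` with triple sums. [folklore] -/
theorem posRoots_three_le_of_card_tripleSums {K B : ℕ} (hK : 0 < K) (d : Fin K → ℕ)
    (hd : ((Finset.univ : Finset (Fin K × Fin K × Fin K)).image
      (fun p => d p.1 + d p.2.1 + d p.2.2)).card ≤ B + 1)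
    (S : Fin K → Matrix (Fin 3) (Fin 3) ℝ) :
    ((Matrix.det (∑ l, ((Polynomial.X : Polynomial ℝ) ^ d l) • (S l).map Polynomial.C)).roots.toFinset.filter
        (fun t => 0 < t)).card ≤ B := by
  have h := (card_posRoots_three_succ_le_card_tripleSums hK d S).trans hd
  omega

/-! ## Worked instances (the two K1 formats; how any line of the Descartes layer is obtained) -/

/-- `(2,6)`, arithmetic-progression support `d = (0,1,2,3,4,5)`: the pair sums take `11` values, so EVERY
`2 × 2` pencil on this support has `Z₊ ≤ 10` (format ceiling: `20`). [folklore] -/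
theorem posRoots_le_ten_on_AP_2_6 (S : Fin 6 → Matrix (Fin 2) (Fin 2) ℝ) :
    ((Matrix.det (∑ l, ((Polynomial.X : Polynomial ℝ) ^ (![0, 1, 2, 3, 4, 5] : Fin 6 → ℕ) l) •
        (S l).map Polynomial.C)).roots.toFinset.filter (fun t => 0 < t)).card ≤ 10 :=
  posRoots_two_le_of_card_pairSums (by norm_num) _ (by decide) S

/-- `(2,6)`, the support `d = (0,1,3,4,9,13)` — two additive coincidences (`1 + 3 = 0 + 4`, `4 + 9 = 0 + 13`),
so the pair sums take `19` values instead of `21` (computed by `decide`): every `2 × 2` pencil on it has `Z₊ ≤ 18`,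
i.e. this support cannot decide the K1 question upward.  (Shown to record the mechanism of the Descartes layer.)
[folklore] -/
theorem posRoots_le_on_2_6_example (S : Fin 6 → Matrix (Fin 2) (Fin 2) ℝ) :
    ((Matrix.det (∑ l, ((Polynomial.X : Polynomial ℝ) ^ (![0, 1, 3, 4, 9, 13] : Fin 6 → ℕ) l) •
        (S l).map Polynomial.C)).roots.toFinset.filter (fun t => 0 < t)).card ≤ 18 :=
  posRoots_two_le_of_card_pairSums (by norm_num) _ (by decide) S

/-- `(3,4)`, support `d = (0,1,2,4)`: the triple sums take `12` values (format ceiling would allow `20`), so every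
`3 × 3` pencil on it has `Z₊ ≤ 11`. [folklore] -/
theorem posRoots_le_eleven_on_3_4_example (S : Fin 4 → Matrix (Fin 3) (Fin 3) ℝ) :
    ((Matrix.det (∑ l, ((Polynomial.X : Polynomial ℝ) ^ (![0, 1, 2, 4] : Fin 4 → ℕ) l) •
        (S l).map Polynomial.C)).roots.toFinset.filter (fun t => 0 < t)).card ≤ 11 :=
  posRoots_three_le_of_card_tripleSums (by norm_num) _ (by decide) S

end Summit.ValiantsHypothesis.ValiantsHypothesis.Theorems.LacunarySymmetroidMatrixDescartes.Census
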